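import Mathlib.Analysis.SpecialFunctions.Pow.Complex
import Mathlib.Analysis.Analytic.Order
import Mathlib.MeasureTheory.Integral.IntervalIntegral.Basic
import Literature.NumberTheory.LFunctions.LiCriterion
import Literature.NumberTheory.LFunctions.LiCoefficientArithmeticFormula
import Literature.NumberTheory.LFunctions.ZetaZeros
import HarnessLib

/-!
# Freitas' Li-type criterion for zero-free half-planes `Re s > τ/2` — statements as printed

LABEL (line 1): **RH-FREE corpus** (typed statements of a published paper; no statement about the
truth of RH is asserted).  The criterion `Freitas2006_thm_1` is a GRADED family in `τ`:
`τ ≥ 2` — RH-FREE and TRUE (`ζ ≠ 0` on `Re s > 1`); `1 < τ < 2` — equivalent to the quasi-Riemann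
hypothesis `QuasiRiemannHypothesis (τ/2)` (OPEN); `τ = 1` — Li's criterion, RH-EQUIVALENT
(`freitasAlpha_one`, tree `li_criterion_holds`); `1/2 ≤ τ < 1` — the FALSE side (some `α_n(τ) < 0`,
`Freitas2006_cor_4_2`).  bears_on: LADDER-RH L-C/L-P (COLUMN 4, LI).  WHAT THIS IS NOT: typing a
printed criterion is transcription; `α_n(1) ≥ 0 ∀ n` is RH re-indexed (Li); formalising the corpus
fixes WHICH inequality would prove RH, it does not move RH; nothing here bears on the truth of RH.

Source: P. Freitas, *A Li-type criterion for zero-free half-planes of Riemann's zeta function*,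
J. London Math. Soc. (2) **73** (2006) 399–414 = arXiv:math/0507368 [Freitas2006LiHalfPlanes].
Locators `pNNNN:Lnn` refer to the materialised arXiv text (`lit read paper:arxiv-math_0507368`,
13 chunks); theorem numbers are the printed ones.

## Dictionary (paper ↦ tree)

* Freitas' `ξ(s) = s(s−1)π^{−s/2}Γ(s/2)ζ(s)` (p0001) is TWICE the tree's
  `Literature.NumberTheory.LFunctions.riemannXi`; every statement below is insensitive to this
  factor (logarithmic derivatives, signs of derivatives, ratios), except the value of `log ξ(τ)` in
  `Freitas2006_F_at_zero`, where the factor `2` is written explicitly, and `Freitas2006_xi_half`.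
* `φ(z) = ξ(1/(1−z))` (p0001, (phidefn)) = tree `liPhi = riemannXi ∘ liMap` (`LiCriterion.lean`);
  `ψ = φ'/φ` = `logDeriv liPhi`; `ℓ = ξ'/ξ` = `logDeriv riemannXi`.
* `λ_n` = tree `keiperLiCoeff n`; `η_k` (p0010:L108–110, `ζ'/ζ(s) = −1/(s−1) − Σ η_k (s−1)^k`) =
  tree `liEta k` (same convention, `LiCoefficientArithmeticFormula.lean`).
* "Σ_ρ over the non-trivial zeros, `ρ` paired with `1 − ρ`" (p0007:L21–23) is typed, as in
  `KeiperLiZeroSum.lean` (`keiperLiCoeff_eq_tsum_zeros`), as the absolutely convergent `tsum` over the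
  subtype `ZetaZeros.riemannZetaNontrivialZeros` of `m(ρ) · Re[term]` with the multiplicity
  `m(ρ) = riemannZetaZeroOrder ρ`; the real parts are absolutely summable and the paired sum is
  real, so the two readings agree (summability is made an explicit conjunct where a sum is asserted).
* "the half-plane `Re s > τ/2` is a zero-free region for the Riemann zeta function" (Thm 1) is typed
  literally for `ζ`: `∀ s, τ/2 < Re s → riemannZeta s ≠ 0` — the OPEN half-plane; for `τ ≥ 1/2`
  it contains no trivial zero, so this is the same for `ξ` (`riemannXi_eq_zero_iff_holds`), and it
  is `QuasiRiemannHypothesis (τ/2)` by `forall_riemannZeta_ne_zero_iff_quasiRiemannHypothesis`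
  (`NymanBeurling.lean`, not imported here).

## Contents (source item ↦ declaration; all numbered statements of §§1–5)

* (dcoeff) p0003:L101–108 ↦ `freitasAlpha`; p0003:L125 "for τ equal to one we recover Li's
  coefficients" ↦ `freitasAlpha_one` (PROVED, `rfl`-level).
* Thm 1 p0003:L134 ↦ `Freitas2006_thm_1`; Thm 2 (i)–(iv) p0004:L26–40 ↦ `Freitas2006_thm_2_i` …
  `_iv`.
* §2: `freitasC` (`c_n(z₀)`, p0005:L95–100); Lemma 2.1 p0005:L8 ↦ `Freitas2006_lemma_2_1`;
  Thm 2.2 :L68 ↦ `Freitas2006_thm_2_2`; the constant `ξ(1/2)` :L82–85 ↦ `Freitas2006_xi_half`;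
  Thm 2.3 :L111 ↦ `Freitas2006_thm_2_3`; Cor 2.4 :L140 ↦ `Freitas2006_cor_2_4`; Cor 2.7 :L160 ↦
  `Freitas2006_cor_2_7`; Thm 2.8 :L177 ↦ `Freitas2006_thm_2_8`; Thm 2.9 p0006:L21 ↦
  `Freitas2006_thm_2_9`.
* §3: `freitasD` (`d_n(z₀)`, p0007:L25–30); Lemma 3.1 (i)/(ii) p0007:L8–37 ↦
  `Freitas2006_lemma_3_1_i`, `Freitas2006_lemma_3_1_ii`; the recurrence (recurr) p0007:L128–131 ↦
  `Freitas2006_recurrence`.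
* §4: Prop 4.1 p0008:L15 ↦ `Freitas2006_prop_4_1` (TYPING NOTE there: the printed inequality
  omits the factor `τ^{n+1}` of Lemma 3.1 (ii); we type what the printed proof proves); Cor 4.2
  :L67 ↦ `Freitas2006_cor_4_2`; Thm 4.3 :L79 ↦ `Freitas2006_thm_4_3`; Lemma 4.4 :L163 ↦
  `Freitas2006_lemma_4_4`.
* §5: `freitasF` (`F(x,τ)`, p0010:L7–13), `α_n = F(n,·)` :L15–17 ↦ `Freitas2006_alpha_eq_F`;
  `F(0,τ) = 0`, `∂F/∂x(0,τ) = log ξ(τ)/τ` :L27–36 ↦ `Freitas2006_F_at_zero`; `freitasEllCoeff`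
  (`ℓ_k(τ)`, p0011:L58–61; `ℓ_k = ℓ_k(0)` p0010:L53); Thm 5.1 p0010:L45 ↦ `Freitas2006_thm_5_1`;
  Cor 5.2 :L94 ↦ `Freitas2006_cor_5_2`; the explicit coefficients :L175–177 ↦
  `Freitas2006_ell_coeff`; `freitasP`, `freitasN` and Cor 5.3 :L116 ↦ `Freitas2006_cor_5_3`;
  Thm 5.5 p0011:L7 ↦ `Freitas2006_thm_5_5`; Thm 5.6 :L48 ↦ `Freitas2006_thm_5_6`.

Everything numbered is typed AS PRINTED as a named fact `def … : Prop` (D-0014); discharges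
(`…_holds`) go to the sibling `FreitasLiHalfPlanesProofs.lean` and its companions (see "Status of the
named facts" below — all are now discharged or refuted).  Dischargeable from the tree:
Thm 1 (both directions: Lemma 3.1 (i) + `bombieriLagarias1999_theorem1` with `ρ ↦ ρ/τ`, exactly as
the paper says on p0004:L1–4; or Li's road `li_lemma_ne_zero` for ⟸), Thm 2 (i) (Leibniz), Lemma 2.1
and Thm 2.2 (the argument of `iteratedDeriv_riemannXi_one_nonneg`), the `τ = 2` rung
(`riemannZeta_ne_zero_of_one_le_re`).

## Deliberately NOT here

* The paper's conjecture (p0011:L41–43: "the sequence `a_n` in Thm 2 goes to zero") — a conjecture,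
  not Literature (planner.md 4b).
* The unnumbered remarks of §4.2 (the autonomous form `β_n(τ) = e^{−τ} α_n(e^{−τ})`, the
  discrete-dynamical-system reading) and of §6.
* No numerics (`ξ(1/2) ≈ .994242` is recorded only as the closed form `Freitas2006_xi_half`).

## Status of the named facts (2026-08-26; docstring-only update, statements unchanged)

All 29 named facts of this module are CLOSED in the kernel: 28 are DISCHARGED (`…_holds`, axioms
`propext`/`Classical.choice`/`Quot.sound` only) in the sibling proof files, and one is REFUTED AS
PRINTED.  Users should cite the `_holds` theorems rather than take `(h : Freitas2006_…)` hypotheses.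

* `FreitasLiHalfPlanesProofs.lean`: `Freitas2006_thm_1_holds` (both directions; also the RH-FREE rung
  `freitasAlpha_nonneg_of_two_le`, `τ ≥ 2`, and the easy direction `freitasAlpha_nonneg_of_riemannZeta_ne_zero`
  for every `τ > 0`), `_thm_2_i_holds`, `_thm_2_ii_holds`, `_thm_2_iii_holds`, `_lemma_2_1_holds`,
  `_thm_2_2_holds`, `_xi_half_holds`, `_thm_2_3_holds`, `_cor_2_4_holds`, `_cor_2_7_holds`,
  `_thm_2_8_pos_holds`, `_thm_2_9_holds`, `_lemma_3_1_i_holds`, `_lemma_3_1_ii_holds`,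
  `_recurrence_holds`, `_prop_4_1_holds` (AS-PROVED form, see the typing note at the decl),
  `_cor_4_2_holds`, `_thm_4_3_holds`, `_lemma_4_4_holds`, `_alpha_eq_F_holds`, `_F_at_zero_holds`,
  `_thm_5_1_holds`, `_cor_5_2_holds`, `_ell_coeff_holds`; and the REFUTATION
  `Freitas2006_thm_2_8_false : ¬ Freitas2006_thm_2_8` (the printed second clause of Thm 2.8 fails at
  `z₀ = −1`, `n = 2`; the first clause is `Freitas2006_thm_2_8_pos`, proved).
* `FreitasLiHalfPlanesSeriesProofs.lean`: `Freitas2006_thm_5_6_holds`, `Freitas2006_thm_5_5_holds`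
  (with `freitasEllCoeff_zero_zero_neg : ℓ₀ < 0`, `abs_freitasEllCoeff_zero_le`).
* `FreitasLiHalfPlanesSignSplitProofs.lean`: `Freitas2006_cor_5_3_holds` (the sign input "η_k > 0 odd /
  < 0 even" for ALL `k` is the tree's `Coffey2008_prop42_holds`, `KeiperLiAsymptoticCriteriaProofs.lean`).
* `FreitasLiHalfPlanesOscillationProofs.lean`: `Freitas2006_thm_2_iv_holds` (with
  `FreitasOscillation.analyticAt_freitasAlpha`, `FreitasOscillation.freitasAlpha_two_pos`).

Nothing of §§1–5 remains a hypothesis; the paper's conjecture "`a_n → 0`" (p0011:L41–43) is not typed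
(see above).  LABEL unchanged: RH-FREE corpus; the `τ = 1` reading of Thm 1 is Li's criterion
(RH-EQUIVALENT, `li_criterion_holds`), and nothing here bears on the truth of RH.

## References

* P. Freitas, J. London Math. Soc. (2) 73 (2006) 399–414; arXiv:math/0507368. [Freitas2006LiHalfPlanes]
* X.-J. Li, J. Number Theory 65 (1997) 325–333. [Li1997]
* E. Bombieri, J. C. Lagarias, J. Number Theory 77 (1999) 274–287, Thm 1, Cor 1. [BombieriLagarias1999]
-/

noncomputable section

open Complex Filter Set
open scoped Nat Topology ComplexOrder

namespace Literature.NumberTheory.LFunctions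

/-! ## §1 The coefficients `α_n(τ)` and the main theorems -/

/-- **Freitas' coefficients** `α_n(τ) = (1/(n−1)!) · dⁿ/dsⁿ [s^{n−1} log ξ(s)] |_{s=τ}` for `n ≥ 1`
and real `τ` (Freitas 2006, (dcoeff) p0003:L101–108, printed with the index shift
`α_{n+1}(τ) = (1/n!) d^{n+1}/ds^{n+1}[sⁿ log ξ(s)]|_{s=τ}, n = 0,1,…`, "where `τ` is a positive number";
Thm 2 and §4 use it on all of `[0,∞)`, Lemma 3.1 for "all real `τ`").  Typed exactly like the tree's
`keiperLiCoeff` with `1` replaced by `τ`: the principal `Complex.log ∘ riemannXi` is holomorphic near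
every real point because `ξ > 0` on `ℝ`; Freitas' `ξ` is `2 ·` the tree's, which changes `log ξ` by the
constant `log 2` and does not affect `α_n` for `n ≥ 1` (`dⁿ/dsⁿ s^{n−1} = 0`).  Real-valued (we take
`re`; the derivative is real).  Junk at `n = 0` (`ℕ`-subtraction: the value is `Re log ξ(τ)`); only
`n ≥ 1` is meaningful.  `α_n(1) = λ_n` (`freitasAlpha_one`). [cite: Freitas2006LiHalfPlanes, §1 eq. (dcoeff) (arXiv p0003:L101)] -/
def freitasAlpha (τ : ℝ) (n : ℕ) : ℝ :=
  (iteratedDeriv n (fun s : ℂ ↦ s ^ (n - 1) * Complex.log (riemannXi s)) τ / ((n - 1)! : ℂ)).re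

/-- "for `τ` equal to one we recover Li's coefficients" (p0003:L125): `α_n(1) = λ_n`
(tree `keiperLiCoeff`, same formula at `s = 1`). [cite: Freitas2006LiHalfPlanes, §1 (arXiv p0003:L125)] -/
theorem freitasAlpha_one (n : ℕ) : freitasAlpha 1 n = keiperLiCoeff n := rfl

/-- **Freitas 2006, Theorem 1** (p0003:L134–138, verbatim): "Given `τ` on `[1/2,∞)`, the half–plane
`Re(s) > τ/2` is a zero–free region for the Riemann zeta function if and only if `α_n(τ)` is
nonnegative for all positive integer `n`."  LABEL per `τ`: `τ ≥ 2` RH-FREE TRUE; `1 < τ < 2` ⟺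
quasi-RH(`τ/2`), OPEN; `τ = 1` ⟺ RH (Li's criterion, `li_criterion_holds`); `1/2 ≤ τ < 1` both sides
FALSE.  Zero-free is typed for `ζ` on the OPEN half-plane (see the module dictionary).  The author
notes (p0004:L1–4) that Bombieri–Lagarias' Theorem 1 with `ρ ↦ ρ/τ` (tree
`bombieriLagarias1999_theorem1`) already gives the zero-side equivalence; the content is its
identification with `α_n` (Lemma 3.1). [cite: Freitas2006LiHalfPlanes, Theorem 1] -/
def Freitas2006_thm_1 : Prop :=
  ∀ τ : ℝ, 1 / 2 ≤ τ →
    ((∀ s : ℂ, τ / 2 < s.re → riemannZeta s ≠ 0) ↔ ∀ n : ℕ, 1 ≤ n → 0 ≤ freitasAlpha τ n)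

/-- **Freitas 2006, Theorem 2 (i)** (p0004:L26–29): for `n = 1, 2, …`,
`α_n(0) = n ξ'(0)/ξ(0) < 0` (the ratio is normalisation-free). [cite: Freitas2006LiHalfPlanes, Theorem 2 (i)] -/
def Freitas2006_thm_2_i : Prop :=
  ∀ n : ℕ, 1 ≤ n →
    freitasAlpha 0 n = n * (deriv riemannXi 0 / riemannXi 0).re ∧ freitasAlpha 0 n < 0

/-- **Freitas 2006, Theorem 2 (ii)** (p0004:L31–32): for `n = 1, 2, …` and `0 ≤ τ < 2`, "there exists
a sequence `1/2 = a_1 > a_2 > …` such that `α_n(a_n) = 0` and `α_n(τ) < 0` for `τ < a_n`"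
(`τ` ranges over `[0,2)` in the theorem, so "`τ < a_n`" is `0 ≤ τ < a_n`).
[cite: Freitas2006LiHalfPlanes, Theorem 2 (ii)] -/
def Freitas2006_thm_2_ii : Prop :=
  ∃ a : ℕ → ℝ, a 1 = 1 / 2 ∧ (∀ n : ℕ, 1 ≤ n → a (n + 1) < a n) ∧
    ∀ n : ℕ, 1 ≤ n → freitasAlpha (a n) n = 0 ∧ ∀ τ : ℝ, 0 ≤ τ → τ < a n → freitasAlpha τ n < 0

/-- **Freitas 2006, Theorem 2 (iii)** (p0004:L34–36): for `n = 1, 2, …` and `0 ≤ τ < 2`, "between any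
two real zeros of `α_n(τ)` there exists at least one real zero of `α_{n+1}(τ)`" (typed for two
distinct zeros `z₁ < z₂` in `[0,2)`; the proof, p0009:L44–49, adds that at a zero of multiplicity `m`
of `α_n` the function `α_{n+1}` vanishes to order `m − 1`). [cite: Freitas2006LiHalfPlanes, Theorem 2 (iii)] -/
def Freitas2006_thm_2_iii : Prop :=
  ∀ n : ℕ, 1 ≤ n → ∀ z₁ z₂ : ℝ, 0 ≤ z₁ → z₁ < z₂ → z₂ < 2 →
    freitasAlpha z₁ n = 0 → freitasAlpha z₂ n = 0 →
      ∃ z : ℝ, z₁ < z ∧ z < z₂ ∧ freitasAlpha z (n + 1) = 0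

/-- **Freitas 2006, Theorem 2 (iv)** (p0004:L38–40): "for any positive integer `N` there exists a
positive integer `n₀` such that the function `α_n(τ)` has at least `N` zeros on the interval `(0,2)`,
for all `n` larger than `n₀`" — zeros counted with multiplicity, as in the proof (p0009:L51–52,
`ν_n`); multiplicity = `analyticOrderNatAt` of the real-analytic `τ ↦ α_n(τ)` (`0` if not analytic or
locally zero, so the count is never inflated by junk). [cite: Freitas2006LiHalfPlanes, Theorem 2 (iv)] -/
def Freitas2006_thm_2_iv : Prop :=
  ∀ N : ℕ, ∃ n₀ : ℕ, ∀ n : ℕ, n₀ < n →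
    ∃ Z : Finset ℝ, (∀ z ∈ Z, 0 < z ∧ z < 2 ∧ freitasAlpha z n = 0) ∧
      N ≤ ∑ z ∈ Z, analyticOrderNatAt (fun t : ℝ ↦ freitasAlpha t n) z

/-! ## §2 Taylor coefficients of `φ` and `ξ` -/

/-- Freitas' `c_n(z₀)`: the Taylor coefficients of `φ(z) = ξ(1/(1−z))` about a real `z₀ ≠ 1`,
`φ(z) = Σ c_n(z₀)(z − z₀)ⁿ`, i.e. `c_n(z₀) = φ⁽ⁿ⁾(z₀)/n!` (p0005:L95–104; radius of convergence
`|1 − z₀|`; Remark 2.5: `c_n(0)` are Li's `a_n`).  With the tree's `φ = liPhi` (half of Freitas'); real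
(we take `re`). Junk at `z₀ = 1`. [cite: Freitas2006LiHalfPlanes, §2 (arXiv p0005:L95)] -/
def freitasC (z₀ : ℝ) (n : ℕ) : ℝ :=
  (iteratedDeriv n liPhi z₀ / (n ! : ℂ)).re

/-- **Freitas 2006, Lemma 2.1** (p0005:L8–26): "Let `f` be an analytic function in an open subset `Ω`
of `ℂ`, and let `z₀ < z₁` be two (real) points in `Ω`. Write `f(z) = Σ a_n (z−z₀)ⁿ = Σ b_n (z−z₁)ⁿ`,
and assume (C1) `a_n` is real and non-negative for `n = 0,1,…`; (C2) the first series is convergent at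
`z = z₁`. Then `b_n ≥ 0` for `n = 0,1,…`. Furthermore, if `a_m > 0` for some integer `m`, then
`b_n > 0` for `n = 0,…,m`."  Typed with `a_n = f⁽ⁿ⁾(z₀)/n!`, `b_n = f⁽ⁿ⁾(z₁)/n!` (signs of `a_n` and
`f⁽ⁿ⁾(z₀)` agree) in the case the paper uses (Thm 2.2: `f = ξ` entire; Cor 2.4: `f = φ` on a disc of
radius `2` about `−1`): `f` holomorphic on a disc about `z₀` reaching beyond `z₁`, so that the first
series is `f`'s expansion and converges at `z₁`; non-negativity in `ℂ` (`0 ≤ w` iff `w` is real and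
`≥ 0`).  -- TODO(general form): `z₁` on the circle of convergence (then Pringsheim's theorem is needed).
[cite: Freitas2006LiHalfPlanes, Lemma 2.1] -/
def Freitas2006_lemma_2_1 : Prop :=
  ∀ (f : ℂ → ℂ) (z₀ z₁ r : ℝ), z₀ < z₁ → z₁ - z₀ < r →
    DifferentiableOn ℂ f (Metric.ball (z₀ : ℂ) r) →
    (∀ n : ℕ, (0 : ℂ) ≤ iteratedDeriv n f z₀) →
      (∀ n : ℕ, (0 : ℂ) ≤ iteratedDeriv n f z₁) ∧
        ∀ m : ℕ, iteratedDeriv m f z₀ ≠ 0 → ∀ n : ℕ, n ≤ m → (0 : ℂ) < iteratedDeriv n f z₁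

/-- **Freitas 2006, Theorem 2.2** (p0005:L68–71; Coffey [coff], Pustyl'nikov [pust] at `z = 1/2`):
"Even derivatives of `ξ` are positive for all real values of `z`, while odd derivatives are positive
for `z > 1/2` and negative for `z < 1/2`."  (Real numbers: the derivatives of `ξ` at real points are
real, `riemannXi_conj`; the even case includes `ξ > 0` on `ℝ`; tree input: the even derivatives at
`1/2` are positive, `iteratedDeriv_two_mul_riemannXi_half_pos`.) [cite: Freitas2006LiHalfPlanes, Theorem 2.2] -/
def Freitas2006_thm_2_2 : Prop :=
  ∀ (z : ℝ) (m : ℕ),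
    0 < (iteratedDeriv (2 * m) riemannXi z).re ∧
      (1 / 2 < z → 0 < (iteratedDeriv (2 * m + 1) riemannXi z).re) ∧
      (z < 1 / 2 → (iteratedDeriv (2 * m + 1) riemannXi z).re < 0)

/-- The explicit constant in the proof of Thm 2.2 (p0005:L82–85):
`s₀(1/2) = ξ(1/2) = −Γ(1/4)ζ(1/2)/(4π^{1/4}) ≈ .994242` for Freitas' `ξ`; for the tree's `ξ` (half
of it) `ξ(1/2) = −Γ(1/4) ζ(1/2)/(8 π^{1/4})`. [cite: Freitas2006LiHalfPlanes, proof of Theorem 2.2 (arXiv p0005:L82)] -/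
def Freitas2006_xi_half : Prop :=
  riemannXi (1 / 2) =
    -(Real.Gamma (1 / 4) * riemannZeta (1 / 2) / (8 * (Real.pi ^ (1 / 4 : ℝ) : ℝ)))

/-- **Freitas 2006, Theorem 2.3** (p0005:L111–114): "For all positive integers `n` different from `1`,
we have that `φ⁽ⁿ⁾(−1) > 0`, while `φ'(−1) = 0`." (`φ = liPhi`; `φ(−1) = ξ(1/2) > 0` is in the proof.)
[cite: Freitas2006LiHalfPlanes, Theorem 2.3] -/
def Freitas2006_thm_2_3 : Prop :=
  (∀ n : ℕ, 2 ≤ n → 0 < (iteratedDeriv n liPhi (-1)).re) ∧ deriv liPhi (-1) = 0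

/-- **Freitas 2006, Corollary 2.4** (p0005:L140–141): "For all `z` in `(−1,1)`, `c_n(z) > 0`"
(all `n ≥ 0`). [cite: Freitas2006LiHalfPlanes, Corollary 2.4] -/
def Freitas2006_cor_2_4 : Prop :=
  ∀ z : ℝ, -1 < z → z < 1 → ∀ n : ℕ, 0 < freitasC z n

/-- **Freitas 2006, Corollary 2.7** (p0005:L160–162): "The functions `c_n : (−1,1) → ℝ⁺` are strictly
monotonically increasing" (proof: `c_n' = (n+1) c_{n+1} > 0`). [cite: Freitas2006LiHalfPlanes, Corollary 2.7] -/
def Freitas2006_cor_2_7 : Prop :=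
  ∀ n : ℕ, StrictMonoOn (fun z : ℝ ↦ freitasC z n) (Set.Ioo (-1) 1)

/-- **Freitas 2006, Theorem 2.8** (p0005:L177–189): for `n = 2, 3, …`,
`c_n(z₀) − c_{n−1}(z₀) > 0` for `z₀ ∈ [0,1)` and `< 0` for `z₀ ∈ [−1,−1/2]`.
AS PRINTED — and FALSE as printed: the second clause fails at `z₀ = −1`, `n = 2` (by the paper's own
Theorem 2.3, `c_2(−1) > 0 = c_1(−1)`), see `Freitas2006_thm_2_8_false` in the proofs file; the first
clause is vendored separately as `Freitas2006_thm_2_8_pos`. [cite: Freitas2006LiHalfPlanes, Theorem 2.8] -/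
def Freitas2006_thm_2_8 : Prop :=
  ∀ n : ℕ, 2 ≤ n →
    (∀ z₀ : ℝ, 0 ≤ z₀ → z₀ < 1 → 0 < freitasC z₀ n - freitasC z₀ (n - 1)) ∧
      ∀ z₀ : ℝ, -1 ≤ z₀ → z₀ ≤ -1 / 2 → freitasC z₀ n - freitasC z₀ (n - 1) < 0

/-- **Freitas 2006, Theorem 2.8, first clause** (p0005:L177–189): for `n = 2, 3, …` and `z₀ ∈ [0,1)`,
`c_n(z₀) − c_{n−1}(z₀) > 0` ("for `z₀` on `[0,1)` these coefficients are also increasing functions of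
`n`", p0005:L173–174).  Vendored separately because the printed theorem's second clause is false
(`Freitas2006_thm_2_8_false`); this clause is the corrected statement of record (misstatement protocol:
new name, old def kept). [cite: Freitas2006LiHalfPlanes, Theorem 2.8 (first clause)] -/
def Freitas2006_thm_2_8_pos : Prop :=
  ∀ n : ℕ, 2 ≤ n → ∀ z₀ : ℝ, 0 ≤ z₀ → z₀ < 1 → 0 < freitasC z₀ n - freitasC z₀ (n - 1)

/-- **Freitas 2006, Theorem 2.9** (p0006:L21–25): "For `z₀ ∈ [0,1)` we have that
`lim_{n→∞} c_n(z₀) = ∞`." [cite: Freitas2006LiHalfPlanes, Theorem 2.9] -/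
def Freitas2006_thm_2_9 : Prop :=
  ∀ z₀ : ℝ, 0 ≤ z₀ → z₀ < 1 → Tendsto (fun n : ℕ ↦ freitasC z₀ n) atTop atTop

/-! ## §3 The series of `ψ = φ'/φ` and the zero-sum form of `α_n` -/

/-- Freitas' `d_n(z₀)`: the Taylor coefficients of `ψ = φ'/φ` about a real `z₀`,
`ψ(z) = Σ d_n(z₀)(z − z₀)ⁿ`, i.e. `d_n(z₀) = ψ⁽ⁿ⁾(z₀)/n!` (Lemma 3.1 (ii), p0007:L25–30); `ψ` is
holomorphic near every real `z₀ ≠ 1` since `φ > 0` on `ℝ ∖ {1}` (p0007:L116–117).  `ψ = logDeriv liPhi`;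
real (we take `re`). Junk at `z₀ = 1`. [cite: Freitas2006LiHalfPlanes, Lemma 3.1 (ii)] -/
def freitasD (z₀ : ℝ) (n : ℕ) : ℝ :=
  (iteratedDeriv n (logDeriv liPhi) z₀ / (n ! : ℂ)).re

/-- **Freitas 2006, Lemma 3.1 (i)** (p0007:L8–23): for each positive integer `n` and real `τ`,
`α_n(τ) = (1/τ) Σ_ρ [1 − (ρ/(ρ−τ))ⁿ]`, "where `ρ` runs over the nontrivial zeros of the zeta function
and the terms corresponding to `ρ` and `1−ρ` are paired together".  Typed for `τ ≠ 0` (at `τ = 0` the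
right side reads `(1/0)·0`; the value `α_n(0)` is Thm 2 (i)) in the tree's absolutely convergent form
(multiplicities `m(ρ)`, real parts; summability is part of the statement).  Proof in print: Hadamard
product `ξ(s) = Π(1 − s/ρ)` and (alphaexpderiv) p0007:L82–94 — the tree's
`keiperLiCoeff_eq_tsum_zeros` is the case `τ = 1`. [cite: Freitas2006LiHalfPlanes, Lemma 3.1 (i)] -/
def Freitas2006_lemma_3_1_i : Prop :=
  ∀ n : ℕ, 1 ≤ n → ∀ τ : ℝ, τ ≠ 0 →
    Summable (fun ρ : ZetaZeros.riemannZetaNontrivialZeros ↦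
      (riemannZetaZeroOrder (ρ : ℂ) : ℝ) * (1 - ((ρ : ℂ) / ((ρ : ℂ) - τ)) ^ n).re) ∧
    freitasAlpha τ n = τ⁻¹ * ∑' ρ : ZetaZeros.riemannZetaNontrivialZeros,
      (riemannZetaZeroOrder (ρ : ℂ) : ℝ) * (1 - ((ρ : ℂ) / ((ρ : ℂ) - τ)) ^ n).re

/-- **Freitas 2006, Lemma 3.1 (ii)** (p0007:L25–37): with `d_n(z₀)` the Taylor coefficients of
`ψ = φ'/φ` at `z₀`, `α_n(τ) = τ^{−(n+1)} d_{n−1}(1 − 1/τ)` (`τ ≠ 0`), i.e.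
`d_{n−1}(1 − 1/τ) = τ^{n+1} α_n(τ)`, for every positive integer `n` and real `τ ≠ 0`.
[cite: Freitas2006LiHalfPlanes, Lemma 3.1 (ii)] -/
def Freitas2006_lemma_3_1_ii : Prop :=
  ∀ n : ℕ, 1 ≤ n → ∀ τ : ℝ, τ ≠ 0 →
    freitasD (1 - 1 / τ) (n - 1) = τ ^ (n + 1) * freitasAlpha τ n

/-- The recurrence between the Taylor coefficients of `φ` and `ψ = φ'/φ` at a point `z₀ ∈ [−1,1)`
(p0007:L118–131, (recurr)): `d_{n−1} = n c_n/c₀ − (1/c₀) Σ_{k=1}^{n−1} c_k d_{n−k−1}`, `n = 1,2,…`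
(from `φ' = φ·ψ`; `c₀ = φ(z₀) > 0`). [cite: Freitas2006LiHalfPlanes, §3 eq. (recurr) (arXiv p0007:L128)] -/
def Freitas2006_recurrence : Prop :=
  ∀ z₀ : ℝ, -1 ≤ z₀ → z₀ < 1 → ∀ n : ℕ, 1 ≤ n →
    freitasD z₀ (n - 1) = n * freitasC z₀ n / freitasC z₀ 0 -
      (freitasC z₀ 0)⁻¹ * ∑ k ∈ Finset.Ico 1 n, freitasC z₀ k * freitasD z₀ (n - k - 1)

/-! ## §4 Properties of the functions `α_n` -/

/-- **Freitas 2006, Proposition 4.1** (p0008:L15–27, the relaxed sufficient condition "in the spirit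
of Corollary 1 in [bola]").  Printed: "Let `g(z) = Σ γ_n (z−z₀)ⁿ` be any function such that the
coefficients `γ_n = γ_n(τ)` are all nonnegative and such that the Taylor series for `g` around `z₀`
has radius of convergence at least `1 − z₀`. Then, given `τ` on `[1/2,∞)`, the half–plane
`Re(s) > τ/2` is a zero–free region for the Riemann zeta function if and only if
`α_n(τ) + γ_{n−1}(τ)` is nonnegative for all positive integer `n`."  Here `z₀ = 1 − 1/τ`,
`1 − z₀ = 1/τ`.  TYPING NOTE (typer rh-crit-dbl-t12, for the referee): the printed proof
(p0008:L29–60: `h = e^{∫g} φ`, `H = h'/h = ψ + g = Σ [d_n(z₀) + γ_n(z₀)](z−z₀)ⁿ`, "proceeding as in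
the second part of the proof of Theorem 1 with `d_n + γ_n` in place of `d_n`") establishes the
criterion for the sign of `d_{n−1}(z₀) + γ_{n−1}`, and `d_{n−1}(z₀) = τ^{n+1} α_n(τ)` by Lemma 3.1 (ii);
the printed `α_n(τ) + γ_{n−1}(τ)` drops the factor `τ^{n+1}` (immaterial at `τ = 1`, where the
statement is Bombieri–Lagarias' Corollary 1 / Li's case).  We type the inequality the proof proves,
`τ^{n+1} α_n(τ) + γ_{n−1} ≥ 0`; read literally, the printed form for `1 < τ < 2` would assert that
corrections of exponential size `γ_{n−1} ≍ cⁿ`, `1 < c < τ`, still detect zeros, which the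
Bombieri–Lagarias oscillation bound does not support.  "Radius of convergence at least `1/τ`" is typed
as absolute convergence of `Σ γ_n rⁿ` for every `0 ≤ r < 1/τ`.
[cite: Freitas2006LiHalfPlanes, Proposition 4.1 (as proved; arXiv p0008:L15-60)] -/
def Freitas2006_prop_4_1 : Prop :=
  ∀ τ : ℝ, 1 / 2 ≤ τ → ∀ γ : ℕ → ℝ, (∀ n, 0 ≤ γ n) →
    (∀ r : ℝ, 0 ≤ r → r < 1 / τ → Summable (fun n : ℕ ↦ γ n * r ^ n)) →
      ((∀ s : ℂ, τ / 2 < s.re → riemannZeta s ≠ 0) ↔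
        ∀ n : ℕ, 1 ≤ n → 0 ≤ τ ^ (n + 1) * freitasAlpha τ n + γ (n - 1))

/-- **Freitas 2006, Corollary 4.2** (p0008:L67–71): "If the half–plane `Re(s) > τ₀/2` is not a
zero–free region of the Riemann zeta function for some `τ₀` on `[1/2,2)`, then there exists a strictly
increasing infinite sequence `n'` such that `α_{n'}(τ₀)` is negative."  (For `1/2 ≤ τ₀ < 1` the
hypothesis HOLDS — zeros on the critical line — so infinitely many `α_n(τ₀) < 0` unconditionally.)
[cite: Freitas2006LiHalfPlanes, Corollary 4.2] -/
def Freitas2006_cor_4_2 : Prop :=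
  ∀ τ₀ : ℝ, 1 / 2 ≤ τ₀ → τ₀ < 2 → ¬ (∀ s : ℂ, τ₀ / 2 < s.re → riemannZeta s ≠ 0) →
    ∃ n' : ℕ → ℕ, StrictMono n' ∧ ∀ k : ℕ, 1 ≤ n' k ∧ freitasAlpha τ₀ (n' k) < 0

/-- **Freitas 2006, Theorem 4.3** (p0008:L79–87, (sysdiff)): "The functions `α_n : ℝ⁺ → ℝ` satisfy
the (infinite) system of differential equations `(τ/n) α_n'(τ) + ((n+1)/n) α_n(τ) = α_{n+1}(τ)`,
`n = 1, 2, …`" (differentiability of `τ ↦ α_n(τ)` on `τ > 0` is part of the statement).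
[cite: Freitas2006LiHalfPlanes, Theorem 4.3] -/
def Freitas2006_thm_4_3 : Prop :=
  ∀ n : ℕ, 1 ≤ n → ∀ τ : ℝ, 0 < τ →
    DifferentiableAt ℝ (fun t : ℝ ↦ freitasAlpha t n) τ ∧
      τ / n * deriv (fun t : ℝ ↦ freitasAlpha t n) τ + (n + 1) / n * freitasAlpha τ n =
        freitasAlpha τ (n + 1)

/-- **Freitas 2006, Lemma 4.4** (p0008:L163–170): "For `0 ≤ τ₁ < τ₂` we have
`∫_{τ₁}^{τ₂} tⁿ α_{n+1}(t) dt = (τ₂^{n+1} α_n(τ₂) − τ₁^{n+1} α_n(τ₁))/n`, `n = 1, …`"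
(proof: `d/dτ[τ^{n+1} α_n(τ)] = n τⁿ α_{n+1}(τ)` from Thm 4.3). [cite: Freitas2006LiHalfPlanes, Lemma 4.4] -/
def Freitas2006_lemma_4_4 : Prop :=
  ∀ n : ℕ, 1 ≤ n → ∀ τ₁ τ₂ : ℝ, 0 ≤ τ₁ → τ₁ < τ₂ →
    ∫ t in τ₁..τ₂, t ^ n * freitasAlpha t (n + 1) =
      (τ₂ ^ (n + 1) * freitasAlpha τ₂ n - τ₁ ^ (n + 1) * freitasAlpha τ₁ n) / n

/-! ## §5 The function `F(x, τ)` extending `α_n(τ)` to real `n` -/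

/-- Freitas' `F : ℝ² → ℝ`, `F(x,τ) = (1/τ) Σ_ρ [1 − (ρ/(ρ−τ))ˣ]` (p0010:L7–13), the zero sum as in
Lemma 3.1 (i) (multiplicities, real parts, `tsum` — junk `0` if not summable; for every real `x` and
`τ` the real parts are absolutely summable), the complex power being the principal one (`Complex.cpow`;
for the paper's range `0 < τ ≤ 2` one has `|ρ/(ρ−τ) − 1| < 1/6` for every zero, so there is no branch
ambiguity; at integer `x` it is the ordinary power).  At `τ = 0` the printed formula reads `(1/0)·0`;
the paper uses the continuous extension there (Thm 2 (i), eq. (limr) p0011:L26–30: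
`lim_{τ→0} F(x,τ) = x·ℓ₀ = x ξ'(0)/ξ(0)`), which we build in. [cite: Freitas2006LiHalfPlanes, §5 (arXiv p0010:L7)] -/
def freitasF (x τ : ℝ) : ℝ :=
  if τ = 0 then x * (logDeriv riemannXi 0).re
  else τ⁻¹ * ∑' ρ : ZetaZeros.riemannZetaNontrivialZeros,
    (riemannZetaZeroOrder (ρ : ℂ) : ℝ) * (1 - ((ρ : ℂ) / ((ρ : ℂ) - τ)) ^ (x : ℂ)).re

/-- "From this and the definition of the coefficients `α_n` it follows that `α_n(τ) = F(n,τ)` for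
`n = 1, …`" (p0010:L15–17; by Lemma 3.1 (i) for `τ ≠ 0`, by Thm 2 (i) at `τ = 0`).
[cite: Freitas2006LiHalfPlanes, §5 (arXiv p0010:L15)] -/
def Freitas2006_alpha_eq_F : Prop :=
  ∀ n : ℕ, 1 ≤ n → ∀ τ : ℝ, freitasAlpha τ n = freitasF n τ

/-- `F(0,τ) = 0` identically and `∂F/∂x (0,τ) = (1/τ) log ξ(τ)`, "giving that this derivative is
negative for `τ` smaller than one and positive for `τ` larger than one" (p0010:L27–36); `ξ` here is
Freitas' `ξ = Π_ρ (1 − s/ρ)` with `ξ(0) = 1`, i.e. `2 ·` the tree's `riemannXi`, whence the explicit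
factor `2`.  Typed for `τ ≠ 0`. [cite: Freitas2006LiHalfPlanes, §5 (arXiv p0010:L27)] -/
def Freitas2006_F_at_zero : Prop :=
  ∀ τ : ℝ, τ ≠ 0 →
    freitasF 0 τ = 0 ∧
      HasDerivAt (fun x : ℝ ↦ freitasF x τ) (Real.log (2 * (riemannXi τ).re) / τ) 0 ∧
      (τ < 1 → Real.log (2 * (riemannXi τ).re) / τ < 0) ∧
      (1 < τ → 0 < Real.log (2 * (riemannXi τ).re) / τ)

/-- Freitas' `ℓ_k(τ) = (1/k!) dᵏ/dτᵏ [ℓ(τ)]`, the Taylor coefficients at a real `τ` of the logarithmic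
derivative `ℓ(s) = ξ'(s)/ξ(s)` (Thm 5.6, p0011:L56–61); `ℓ_k = ℓ_k(0)` are the coefficients of Thm 5.1
(p0010:L53–54).  `ℓ = logDeriv riemannXi` (normalisation-free); real (we take `re`).
[cite: Freitas2006LiHalfPlanes, Theorem 5.6 (definition of ℓ_k(τ))] -/
def freitasEllCoeff (τ : ℝ) (k : ℕ) : ℝ :=
  (iteratedDeriv k (logDeriv riemannXi) τ / (k ! : ℂ)).re

/-- **Freitas 2006, Theorem 5.1** (p0010:L45–55): "`F(x,τ) = Σ_{k≥0} (ℓ_k/(k+1)!) (Γ(x+k+1)/Γ(x)) τᵏ`,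
`|τ| < R`, `x ∈ ℂ`, where `ℓ_k` are the Taylor coefficients of the function `ℓ(s) = ξ'(s)/ξ(s)` around
zero and `R` is the absolute value of the first zero of the zeta function on the critical line."
`Γ(x+k+1)/Γ(x)` is the polynomial `x(x+1)⋯(x+k)` (its meaning at the poles of `Γ`, as in the proof,
p0010:L68–71).  Typed for real `x` (the tree's `F` is a function on `ℝ²`, as printed on p0010:L8;
-- TODO(general form): `x ∈ ℂ`) and with "`|τ| < R`" in the form the proof uses (p0010:L85–86: the
only `τ`-singularities of `F` are the zeros of `ξ`): `|τ| < |ρ|` for every non-trivial zero `ρ` —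
i.e. `|τ| <` the least modulus of a zero, which is the modulus `≈ 14.1` of the first critical zero.
[cite: Freitas2006LiHalfPlanes, Theorem 5.1] -/
def Freitas2006_thm_5_1 : Prop :=
  ∀ x τ : ℝ, (∀ ρ ∈ ZetaZeros.riemannZetaNontrivialZeros, |τ| < ‖ρ‖) →
    HasSum (fun k : ℕ ↦ freitasEllCoeff 0 k / ((k + 1)! : ℝ) *
      (∏ j ∈ Finset.range (k + 1), (x + j)) * τ ^ k) (freitasF x τ)

/-- **Freitas 2006, Corollary 5.2** (p0010:L94–100): "Let `p` be a positive integer. Then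
`F(−p,τ) = Σ_{k=0}^{p−1} (ℓ_k/(k+1)!) Π_{j=0}^{k}(j−p) τᵏ`" (at negative integers `F` is a polynomial in
`τ`). [cite: Freitas2006LiHalfPlanes, Corollary 5.2] -/
def Freitas2006_cor_5_2 : Prop :=
  ∀ p : ℕ, 1 ≤ p → ∀ τ : ℝ,
    freitasF (-(p : ℝ)) τ = ∑ k ∈ Finset.range p,
      freitasEllCoeff 0 k / ((k + 1)! : ℝ) * (∏ j ∈ Finset.range (k + 1), ((j : ℝ) - p)) * τ ^ k

/-- The explicit Taylor coefficients of `ℓ = ξ'/ξ` at `0` (proof of Cor 5.3, p0010:L172–180):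
`ℓ(s) = log(2√π) − 1 − γ/2 + Σ_{k≥1} [−1 + (1 − 2^{−k−1}) ζ(k+1) + (−1)ᵏ η_k] sᵏ`, i.e.
`ℓ₀ = log(2√π) − 1 − γ/2` and `ℓ_k = −1 + (1−2^{−k−1})ζ(k+1) + (−1)ᵏ η_k` for `k ≥ 1`
(`γ` = Euler's constant, `η_k` = tree `liEta k`). [cite: Freitas2006LiHalfPlanes, proof of Corollary 5.3 (arXiv p0010:L175)] -/
def Freitas2006_ell_coeff : Prop :=
  freitasEllCoeff 0 0 =
      Real.log (2 * Real.sqrt Real.pi) - 1 - Real.eulerMascheroniConstant / 2 ∧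
    ∀ k : ℕ, 1 ≤ k → freitasEllCoeff 0 k =
      -1 + (1 - (2 : ℝ)⁻¹ ^ (k + 1)) * (riemannZeta (k + 1)).re + (-1) ^ k * liEta k

/-- Freitas' `P(x,τ) = Σ_{k≥1} (1/(k+1)!) (Γ(x+k+1)/Γ(x)) [(1 − 2^{−(k+1)}) ζ(k+1) − 1] τᵏ`
(Cor 5.3, p0010:L118–122; the series converges for `|τ| < 2`; `tsum`, junk `0` otherwise;
`Γ(x+k+1)/Γ(x) = x(x+1)⋯(x+k)`). [cite: Freitas2006LiHalfPlanes, Corollary 5.3] -/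
def freitasP (x τ : ℝ) : ℝ :=
  ∑' k : ℕ, (((k + 2)! : ℝ))⁻¹ * (∏ j ∈ Finset.range (k + 2), (x + j)) *
    ((1 - (2 : ℝ)⁻¹ ^ (k + 2)) * (riemannZeta (k + 2)).re - 1) * τ ^ (k + 1)

/-- Freitas' `N(x,τ) = [log(2√π) − 1 − γ/2] x + Σ_{k≥1} ((−1)ᵏ/(k+1)!) (Γ(x+k+1)/Γ(x)) η_k τᵏ`
(Cor 5.3, p0010:L126–131; converges for `|τ| < 3`; `η_k = liEta k`). [cite: Freitas2006LiHalfPlanes, Corollary 5.3] -/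
def freitasN (x τ : ℝ) : ℝ :=
  (Real.log (2 * Real.sqrt Real.pi) - 1 - Real.eulerMascheroniConstant / 2) * x +
    ∑' k : ℕ, (-1) ^ (k + 1) / (((k + 2)! : ℝ)) * (∏ j ∈ Finset.range (k + 2), (x + j)) *
      liEta (k + 1) * τ ^ (k + 1)

/-- **Freitas 2006, Corollary 5.3** (p0010:L116–138): with `P`, `N` as defined (`freitasP`, `freitasN`),
"for positive `x` and `τ`, the functions `P` and `N` are positive and negative, respectively, and
`F(x,τ) = P(x,τ) + N(x,τ)`" (Remark 5.4: this generalises Coffey's two-part expression for `λ_n`; the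
signs rest on `(1−2^{−k−1})ζ(k+1) > 1` and on `η_k > 0` for odd `k`, `< 0` for even `k` [coff2]).
Typed for `0 < τ < 2`, the range in which the series `P` converges (the printed "positive `τ`" is
meaningful only there), with the convergence of both series as explicit conjuncts.
[cite: Freitas2006LiHalfPlanes, Corollary 5.3] -/
def Freitas2006_cor_5_3 : Prop :=
  ∀ x τ : ℝ, 0 < x → 0 < τ → τ < 2 →
    Summable (fun k : ℕ ↦ (((k + 2)! : ℝ))⁻¹ * (∏ j ∈ Finset.range (k + 2), (x + j)) *
      ((1 - (2 : ℝ)⁻¹ ^ (k + 2)) * (riemannZeta (k + 2)).re - 1) * τ ^ (k + 1)) ∧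
    Summable (fun k : ℕ ↦ (-1) ^ (k + 1) / (((k + 2)! : ℝ)) *
      (∏ j ∈ Finset.range (k + 2), (x + j)) * liEta (k + 1) * τ ^ (k + 1)) ∧
    0 < freitasP x τ ∧ freitasN x τ < 0 ∧ freitasF x τ = freitasP x τ + freitasN x τ

/-- **Freitas 2006, Theorem 5.5** (p0011:L7–13): "There exist positive constants `τ₀` and `x₀` such
that `F` takes on negative values on the set `X = {(x,τ) ∈ ℝ² : x₀ < x < τ₀/τ}`" (`τ > 0` is implicit
in `τ₀/τ` and in the proof, `τ = r t`, `0 < t < τ₀`, `r > 0`). [cite: Freitas2006LiHalfPlanes, Theorem 5.5] -/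
def Freitas2006_thm_5_5 : Prop :=
  ∃ τ₀ x₀ : ℝ, 0 < τ₀ ∧ 0 < x₀ ∧
    ∀ x τ : ℝ, 0 < τ → x₀ < x → x < τ₀ / τ → freitasF x τ < 0

/-- **Freitas 2006, Theorem 5.6** (p0011:L48–61): "`F(x,τ) = Σ_{k≥0} Γ(x+1)/((k+1)! Γ(x−k)) ℓ_k(τ) τᵏ`,
where `ℓ_k(τ) = (1/k!) dᵏ/dτᵏ[ℓ(τ)]`"; `Γ(x+1)/Γ(x−k)` is the polynomial `x(x−1)⋯(x−k)`.  No range is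
printed; the proof (p0011:L65–84) expands `(1 + τ/(ρ−τ))ˣ` by the binomial series, which requires
`|τ/(ρ−τ)| < 1` for every zero `ρ` — typed as that hypothesis (it holds for all `0 < τ ≤ 2`, indeed
far beyond). [cite: Freitas2006LiHalfPlanes, Theorem 5.6] -/
def Freitas2006_thm_5_6 : Prop :=
  ∀ x τ : ℝ, (∀ ρ ∈ ZetaZeros.riemannZetaNontrivialZeros, |τ| < ‖ρ - τ‖) →
    HasSum (fun k : ℕ ↦ (∏ j ∈ Finset.range (k + 1), (x - j)) / ((k + 1)! : ℝ) *
      freitasEllCoeff τ k * τ ^ k) (freitasF x τ)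

end Literature.NumberTheory.LFunctions
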